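import Summits.KontsevichZagierPeriods.KontsevichZagierPeriods.Theorems.LinRedNormalFormArrangementNormalFormSeparateTwoHIPole

/-!
# The Taylor pieces on the thin sectors at a point off the pole line

(Line `janus-bands`, crux `ArrangementNormalForm`, stub `stub_separateTwoPos_hI`, part `HIAway`.)
At a base point `x₁` OFF the pole line (`λ₁ = y₁ − ℓ(x₁) ≠ 0`) where no active `x`-letter
vanishes (wall block `W₁(ξ)`, `W₁(0) ≠ 0`), with the numerator in double Taylor form
`∑_{i<N} (∑_{m<N'} cc(i,m) ξ^m) λ^i` having some `cc ≠ 0`, the density `g = 𝟙_Y (∑ |Ri i|) m`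
(part `HISector`) has finite integral over the thin sectors of finite slope (`hsector_away`) and
the vertical thin sectors (`vsector_away`) at `x₁`, for all `(δ, ε)` satisfying explicit
smallness conditions and the inside/outside dichotomy: along the sector the re-centred numerator
(`SepTwo.sum_recentre`) is a `usum` (part `HINum`), the denominator is the two-sided bounded
regular factor `ω = |W₁(ξ)| |λ|^n`, the pieces are bounded, and the weight itself is integrable
by the ray theorem `SepTwo.ray_away` (part `HIRayMain`). Registered in literal form as
`separateTwo_hiAway`.
-/

noncomputable section

open Set MeasureTheory
open scoped ENNReal

namespace Summit.KontsevichZagierPeriods.ArrangementNormalForm.JanusBands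

namespace SepTwo

/-! ### Small tools -/

/-- Two-sided bounds for `λ₁ + w`, `|w| ≤ |λ₁|/2`. -/
theorem lam_bounds {l w : ℝ} (hw : |w| ≤ |l| / 2) :
    |l| / 2 ≤ |l + w| ∧ |l + w| ≤ 3 * |l| / 2 := by
  constructor
  · have := abs_sub_abs_le_abs_sub l (-w)
    rw [abs_neg, sub_neg_eq_add] at this
    linarith
  · have := abs_add_le l w
    linarith

/-- The transversal increment is small on a small sector of finite slope. -/
theorem tu_small {s σ l δ ε t v : ℝ} (hσ : |σ| = 1) (hε1 : 4 * ε ≤ 1)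
    (hδl : 4 * δ * (|s| + 1) ≤ |l| / 2) (ht : t ∈ Ioo (0 : ℝ) (4 * δ))
    (hv : v ∈ Ioo (0 : ℝ) (4 * ε)) : |t * (s + σ * v)| ≤ |l| / 2 := by
  have h1 : |s + σ * v| ≤ |s| + 1 := by
    calc |s + σ * v| ≤ |s| + |σ * v| := abs_add_le _ _
      _ = |s| + v := by rw [abs_mul, hσ, one_mul, abs_of_pos hv.1]
      _ ≤ |s| + 1 := by linarith [hv.2]
  rw [abs_mul, abs_of_pos ht.1]
  calc t * |s + σ * v| ≤ 4 * δ * (|s| + 1) :=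
        mul_le_mul ht.2.le h1 (abs_nonneg _) (by linarith [ht.1, ht.2])
    _ ≤ |l| / 2 := hδl

/-- A uniform bound for the piece numerators. -/
theorem abs_piece_num_le (cc : ℕ × ℕ → ℝ) (N N' : ℕ) {ξ lam B : ℝ} (hξ : |ξ| ≤ 1) (hB : |lam| ≤ B)
    (i : ℕ) (hi : i ∈ Finset.range N) :
    |(∑ m ∈ Finset.range N', cc (i, m) * ξ ^ m) * lam ^ i| ≤
      ∑ i' ∈ Finset.range N, (∑ m ∈ Finset.range N', |cc (i', m)|) * B ^ i' := by
  have hB0 : 0 ≤ B := (abs_nonneg _).trans hB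
  calc |(∑ m ∈ Finset.range N', cc (i, m) * ξ ^ m) * lam ^ i|
      = |∑ m ∈ Finset.range N', cc (i, m) * ξ ^ m| * |lam| ^ i := by rw [abs_mul, abs_pow]
    _ ≤ (∑ m ∈ Finset.range N', |cc (i, m)|) * B ^ i :=
        mul_le_mul (abs_inner_le cc N' hξ i) (pow_le_pow_left₀ (abs_nonneg _) hB i)
          (by positivity) (Finset.sum_nonneg fun _ _ => abs_nonneg _)
    _ ≤ ∑ i' ∈ Finset.range N, (∑ m ∈ Finset.range N', |cc (i', m)|) * B ^ i' :=
        Finset.single_le_sum (f := fun i' => (∑ m ∈ Finset.range N', |cc (i', m)|) * B ^ i')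
          (fun i' _ => by positivity) hi

/-! ### Sectors of finite slope -/

/-- The denominator along a sector of finite slope off the pole line. -/
theorem aframe_den {n : ℕ} {W₁ : ℝ → ℝ} {P₀ s σ l t v : ℝ} (hW : 0 < |W₁ (t * P₀)|)
    (hl : 0 < |l + t * (s + σ * v)|) :
    |W₁ (t * P₀) * (l + t * (s + σ * v)) ^ n| =
      t ^ 0 * |s + σ * v| ^ 0 * (|W₁ (t * P₀)| * |l + t * (s + σ * v)| ^ n) ∧
    0 < t ^ 0 * |s + σ * v| ^ 0 * (|W₁ (t * P₀)| * |l + t * (s + σ * v)| ^ n) := by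
  refine ⟨?_, by positivity⟩
  rw [pow_zero, pow_zero, one_mul, one_mul, abs_mul, abs_pow]

/-- **The density on a thin sector of finite slope at a point off the pole line is finite.** -/
theorem hsector_away {k m' : ℕ} (M : Fin m' → Atm 2) (lo hi : Fin k → Fin k ⊕ Atm 2)
    (a : Fin k → Option (Atm 2)) (N N' : ℕ) (cc : ℕ × ℕ → ℝ) (n : ℕ) (W₁ : ℝ → ℝ)
    (l₁ l₂ : ℝ) (x₁ : Fin 2 → ℝ) (R : (Fin 2 → ℝ) → ℝ) (Ri : ℕ → (Fin 2 → ℝ) → ℝ)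
    (hlam : x₁ 1 - (l₁ * x₁ 0 + l₂) ≠ 0) (hcc : ∃ im ∈ Finset.range N ×ˢ Finset.range N', cc im ≠ 0)
    (hR : ∀ x, R x = (∑ i ∈ Finset.range N, (∑ m ∈ Finset.range N', cc (i, m) * (x 0 - x₁ 0) ^ m) *
      (x 1 - (l₁ * x 0 + l₂)) ^ i) / (W₁ (x 0 - x₁ 0) * (x 1 - (l₁ * x 0 + l₂)) ^ n))
    (hRi : ∀ i ∈ Finset.range N, ∀ x, Ri i x = (∑ m ∈ Finset.range N', cc (i, m) * (x 0 - x₁ 0) ^ m) *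
      (x 1 - (l₁ * x 0 + l₂)) ^ i / (W₁ (x 0 - x₁ 0) * (x 1 - (l₁ * x 0 + l₂)) ^ n))
    (hRm : Measurable R) (hRim : ∀ i, Measurable (Ri i)) (hW₁c : Continuous W₁) (hW₁0 : W₁ 0 ≠ 0)
    {ρW CW : ℝ} (hρW1 : ρW ≤ 1) (hWb : ∀ u : ℝ, |u| < ρW → |W₁ 0| / 2 ≤ |W₁ u| ∧ |W₁ u| ≤ CW)
    (hfinY : ∫⁻ x in {x | ∀ j, 0 < av x (M j)}, ENNReal.ofReal |R x| * lmass lo hi a (av x) < ∞)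
    {P₀ s σ : ℝ} (hP₀ : P₀ ≠ 0) (hσ : |σ| = 1)
    (P Q : Fin 2 → ℝ) (hP : P = ![P₀, P₀ * l₁ + s]) (hQ : Q = ![0, σ])
    {δ₀ ε₀ : ℝ} {KΛ CΛ : ℝ≥0∞} {Kn : ℕ} (hKΛ : KΛ ≠ ∞) (hCΛ : CΛ ≠ ∞)
    (hmono : ∀ δ ε : ℝ, 4 * δ ≤ δ₀ → 4 * ε ≤ ε₀ → ∀ x v x' v' : ℝ, 0 < x → x ≤ x' → x' ≤ 4 * x →
      x' < 4 * δ → 0 < v → v ≤ v' → v' ≤ 4 * v → v' < 4 * ε →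
      lmass lo hi a (av (bpt x₁ P Q x v)) ≤ KΛ * lmass lo hi a (av (bpt x₁ P Q x' v')))
    (hang : ∀ δ ε : ℝ, δ ≤ δ₀ → ε ≤ ε₀ → ∀ x : ℝ, 0 < x → x < δ → ∀ v v' : ℝ, 0 < v → v ≤ v' →
      v' < ε → lmass lo hi a (av (bpt x₁ P Q x v)) ≤
        CΛ * ENNReal.ofReal ((1 + Real.log (v' / v)) ^ Kn) * lmass lo hi a (av (bpt x₁ P Q x v')))
    (hrad : ∀ δ ε : ℝ, δ ≤ δ₀ → ε ≤ ε₀ → ∀ v : ℝ, 0 < v → v < ε → ∀ x x' : ℝ, 0 < x → x ≤ x' →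
      x' < δ → lmass lo hi a (av (bpt x₁ P Q x v)) ≤
        CΛ * ENNReal.ofReal ((1 + Real.log (x' / x)) ^ Kn) * lmass lo hi a (av (bpt x₁ P Q x' v)))
    {δ ε : ℝ} (hδ : 0 < δ) (hε : 0 < ε) (h4δ : 4 * δ ≤ δ₀) (h4ε : 4 * ε ≤ ε₀)
    (hδW : 4 * δ * |P₀| ≤ ρW) (hε1 : 4 * ε ≤ 1)
    (hδl : 4 * δ * (|s| + 1) ≤ |x₁ 1 - (l₁ * x₁ 0 + l₂)| / 2)
    (hsign : (∀ t ∈ Ioo (0 : ℝ) (4 * δ), ∀ v ∈ Ioo (0 : ℝ) (4 * ε),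
        bpt x₁ P Q t v ∈ {x : Fin 2 → ℝ | ∀ j, 0 < av x (M j)}) ∨
      (∀ t ∈ Ioo (0 : ℝ) (4 * δ), ∀ v ∈ Ioo (0 : ℝ) (4 * ε),
        bpt x₁ P Q t v ∉ {x : Fin 2 → ℝ | ∀ j, 0 < av x (M j)})) :
    ∫⁻ z in sector x₁ P Q δ (Ico 0 ε), {x : Fin 2 → ℝ | ∀ j, 0 < av x (M j)}.indicator
      (fun x => (∑ i ∈ Finset.range N, ENNReal.ofReal |Ri i x|) * lmass lo hi a (av x)) z < ∞ := by
  have hYm := measurableSet_Y M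
  set lam₁ := x₁ 1 - (l₁ * x₁ 0 + l₂) with hlam₁
  set m : (Fin 2 → ℝ) → ℝ≥0∞ := fun x => lmass lo hi a (av x) with hm_def
  have hm : Measurable m := measurable_lmass_av lo hi a
  have hdet : P 0 * Q 1 - Q 0 * P 1 ≠ 0 := by
    rw [hP, hQ, hframe_det]; exact mul_ne_zero hP₀ (sigma_ne_zero hσ)
  rcases hsign with hin4 | hout
  swap
  · rw [sector_zero N x₁ P Q hYm hm hRim hdet fun t ht v hv => hout t (Ioo_four hδ ht) v (Ioo_four hε hv)]
    exact ENNReal.zero_lt_top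
  have hin : ∀ t ∈ Ioo (0 : ℝ) δ, ∀ v ∈ Ioo (0 : ℝ) ε,
      bpt x₁ P Q t v ∈ {x : Fin 2 → ℝ | ∀ j, 0 < av x (M j)} := fun t ht v hv =>
    hin4 t (Ioo_four hδ ht) v (Ioo_four hε hv)
  refine sector_finite N x₁ P Q hYm hm hRim hdet hin ?_
  have hfin := hfin_of_inside x₁ P Q hm hRm hfinY hdet hin4
  -- the data of the ray theorem
  set T := Finset.range N ×ˢ Finset.range N' with hT
  set κ' : ℕ × ℕ → ℝ := fun im => recentre N cc lam₁ im * P₀ ^ im.2 with hκ'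
  set ω : ℝ → ℝ → ℝ := fun t v => |W₁ (t * P₀)| * |lam₁ + t * (s + σ * v)| ^ n with hω_def
  set Λ' : ℝ → ℝ → ℝ≥0∞ := fun t v => m (bpt x₁ P Q t v) with hΛ'
  have hωm : Measurable (Function.uncurry ω) := by
    refine Measurable.mul ?_ ?_
    · exact continuous_abs.measurable.comp (hW₁c.measurable.comp (measurable_fst.mul_const _))
    · refine (continuous_abs.measurable.comp ?_).pow_const n
      exact measurable_const.add (measurable_fst.mul (measurable_const.add (measurable_snd.const_mul _)))
  have hΛm : Measurable (Function.uncurry Λ') := measurable_lmass_bpt lo hi a x₁ P Q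
  have htP : ∀ t ∈ Ioo (0 : ℝ) (4 * δ), |t * P₀| < ρW := fun t ht => by
    rw [abs_mul, abs_of_pos ht.1]
    calc t * |P₀| < 4 * δ * |P₀| := mul_lt_mul_of_pos_right ht.2 (abs_pos.2 hP₀)
      _ ≤ ρW := hδW
  have hWt : ∀ t ∈ Ioo (0 : ℝ) (4 * δ), |W₁ 0| / 2 ≤ |W₁ (t * P₀)| ∧ |W₁ (t * P₀)| ≤ CW :=
    fun t ht => hWb _ (htP t ht)
  have hW0 : 0 < |W₁ 0| / 2 := half_pos (abs_pos.2 hW₁0)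
  have hl0 : 0 < |lam₁| / 2 := half_pos (abs_pos.2 hlam)
  have hlt : ∀ t ∈ Ioo (0 : ℝ) (4 * δ), ∀ v ∈ Ioo (0 : ℝ) (4 * ε),
      |lam₁| / 2 ≤ |lam₁ + t * (s + σ * v)| ∧ |lam₁ + t * (s + σ * v)| ≤ 3 * |lam₁| / 2 :=
    fun t ht v hv => lam_bounds (tu_small hσ hε1 hδl ht hv)
  have hωlo : 0 < |W₁ 0| / 2 * (|lam₁| / 2) ^ n := mul_pos hW0 (pow_pos hl0 n)
  have hω : ∀ t ∈ Ioo (0 : ℝ) (4 * δ), ∀ v ∈ Ioo (0 : ℝ) (4 * ε),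
      |W₁ 0| / 2 * (|lam₁| / 2) ^ n ≤ ω t v ∧ ω t v ≤ CW * (3 * |lam₁| / 2) ^ n := fun t ht v hv =>
    ⟨mul_le_mul (hWt t ht).1 (pow_le_pow_left₀ hl0.le (hlt t ht v hv).1 n) (by positivity)
        (abs_nonneg _),
      mul_le_mul (hWt t ht).2 (pow_le_pow_left₀ (abs_nonneg _) (hlt t ht v hv).2 n) (by positivity)
        ((abs_nonneg _).trans (hWt t ht).2)⟩
  have hden : ∀ t ∈ Ioo (0 : ℝ) (4 * δ), ∀ v ∈ Ioo (0 : ℝ) (4 * ε),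
      |W₁ (t * P₀) * (lam₁ + t * (s + σ * v)) ^ n| = t ^ 0 * |s + σ * v| ^ 0 * ω t v ∧
      0 < t ^ 0 * |s + σ * v| ^ 0 * ω t v := fun t ht v hv =>
    aframe_den (hW0.trans_le (hWt t ht).1) (hl0.trans_le (hlt t ht v hv).1)
  -- the integrand and the pieces in blown-up coordinates
  have hR' : ∀ t ∈ Ioo (0 : ℝ) (4 * δ), ∀ v ∈ Ioo (0 : ℝ) (4 * ε),
      ENNReal.ofReal t * (ENNReal.ofReal |R (bpt x₁ P Q t v)| * m (bpt x₁ P Q t v)) =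
        ENNReal.ofReal |usum T κ' Prod.fst t (s + σ * v)| * wt 0 0 s σ ω Λ' t v := by
    intro t ht v hv
    rw [hR, hP, hQ, hframe_fst, hframe_lam, dsum_fst_recentre cc N N' lam₁ P₀ t (s + σ * v)]
    simp only [wt, phi]
    rw [← hP, ← hQ]
    exact piece_eq_wt ht.1.le rfl (hden t ht v hv).1 (hden t ht v hv).2 _
  set Cb : ℝ := ∑ i' ∈ Finset.range N, (∑ m ∈ Finset.range N', |cc (i', m)|) * (3 * |lam₁| / 2) ^ i'
    with hCb
  have hRi' : ∀ i ∈ Finset.range N, ∀ t ∈ Ioo (0 : ℝ) δ, ∀ v ∈ Ioo (0 : ℝ) ε,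
      ENNReal.ofReal t * (ENNReal.ofReal |Ri i (bpt x₁ P Q t v)| * m (bpt x₁ P Q t v)) ≤
        ENNReal.ofReal Cb * wt 0 0 s σ ω Λ' t v := by
    intro i hi t ht v hv
    have ht4 := Ioo_four hδ ht
    have hv4 := Ioo_four hε hv
    rw [hRi i hi, hP, hQ, hframe_fst, hframe_lam]
    simp only [wt, phi]
    rw [← hP, ← hQ]
    refine piece_le_wt ht.1.le (abs_piece_num_le cc N N' ((htP t ht4).le.trans hρW1)
      (hlt t ht4 v hv4).2 i hi) (hden t ht4 v hv4).1 (hden t ht4 v hv4).2 _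
  have hmono' := hmono δ ε h4δ h4ε
  have hang' := hang δ ε (by linarith) (by linarith)
  have hrad' := hrad δ ε (by linarith) (by linarith)
  have hne : ∃ im ∈ T, κ' im ≠ 0 :=
    exists_ne_zero_fst (exists_recentre_ne_zero N N' cc lam₁ hcc) hP₀
  exact step_away N x₁ P Q T κ' Prod.fst s σ ω Λ' (ENNReal.ofReal Cb) ENNReal.ofReal_ne_top hR' hRi'
    (fun h => ray_away T κ' Prod.fst (N + N') (deg_prod N N') (fst_le_prod N N') (inj_fst T) hσ
      hωm hΛm hδ hε hωlo hω KΛ hKΛ hmono' Kn CΛ hCΛ hang' hrad' h hne) hfin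

/-! ### Vertical sectors -/

/-- The denominator along a vertical sector off the pole line. -/
theorem vframe_den_away {n : ℕ} {W₁ : ℝ → ℝ} {p q₀ l t v : ℝ} (hW : 0 < |W₁ (t * (v * q₀))|)
    (hl : 0 < |l + t * p|) :
    |W₁ (t * (v * q₀)) * (l + t * p) ^ n| =
      t ^ 0 * |v| ^ 0 * (|W₁ (t * (v * q₀))| * |l + t * p| ^ n) ∧
    0 < t ^ 0 * |v| ^ 0 * (|W₁ (t * (v * q₀))| * |l + t * p| ^ n) := by
  refine ⟨?_, by positivity⟩
  rw [pow_zero, pow_zero, one_mul, one_mul, abs_mul, abs_pow]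

/-- **The density on a vertical thin sector at a point off the pole line is finite.** -/
theorem vsector_away {k m' : ℕ} (M : Fin m' → Atm 2) (lo hi : Fin k → Fin k ⊕ Atm 2)
    (a : Fin k → Option (Atm 2)) (N N' : ℕ) (cc : ℕ × ℕ → ℝ) (n : ℕ) (W₁ : ℝ → ℝ)
    (l₁ l₂ : ℝ) (x₁ : Fin 2 → ℝ) (R : (Fin 2 → ℝ) → ℝ) (Ri : ℕ → (Fin 2 → ℝ) → ℝ)
    (hlam : x₁ 1 - (l₁ * x₁ 0 + l₂) ≠ 0) (hcc : ∃ im ∈ Finset.range N ×ˢ Finset.range N', cc im ≠ 0)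
    (hR : ∀ x, R x = (∑ i ∈ Finset.range N, (∑ m ∈ Finset.range N', cc (i, m) * (x 0 - x₁ 0) ^ m) *
      (x 1 - (l₁ * x 0 + l₂)) ^ i) / (W₁ (x 0 - x₁ 0) * (x 1 - (l₁ * x 0 + l₂)) ^ n))
    (hRi : ∀ i ∈ Finset.range N, ∀ x, Ri i x = (∑ m ∈ Finset.range N', cc (i, m) * (x 0 - x₁ 0) ^ m) *
      (x 1 - (l₁ * x 0 + l₂)) ^ i / (W₁ (x 0 - x₁ 0) * (x 1 - (l₁ * x 0 + l₂)) ^ n))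
    (hRm : Measurable R) (hRim : ∀ i, Measurable (Ri i)) (hW₁c : Continuous W₁) (hW₁0 : W₁ 0 ≠ 0)
    {ρW CW : ℝ} (hρW1 : ρW ≤ 1) (hWb : ∀ u : ℝ, |u| < ρW → |W₁ 0| / 2 ≤ |W₁ u| ∧ |W₁ u| ≤ CW)
    (hfinY : ∫⁻ x in {x | ∀ j, 0 < av x (M j)}, ENNReal.ofReal |R x| * lmass lo hi a (av x) < ∞)
    {p q₀ : ℝ} (hp : |p| = 1) (hq₀ : |q₀| = 1)
    (P Q : Fin 2 → ℝ) (hP : P = ![0, p]) (hQ : Q = ![q₀, q₀ * l₁])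
    {δ₀ ε₀ : ℝ} {KΛ CΛ : ℝ≥0∞} {Kn : ℕ} (hKΛ : KΛ ≠ ∞) (hCΛ : CΛ ≠ ∞)
    (hmono : ∀ δ ε : ℝ, 4 * δ ≤ δ₀ → 4 * ε ≤ ε₀ → ∀ x v x' v' : ℝ, 0 < x → x ≤ x' → x' ≤ 4 * x →
      x' < 4 * δ → 0 < v → v ≤ v' → v' ≤ 4 * v → v' < 4 * ε →
      lmass lo hi a (av (bpt x₁ P Q x v)) ≤ KΛ * lmass lo hi a (av (bpt x₁ P Q x' v')))
    (hang : ∀ δ ε : ℝ, δ ≤ δ₀ → ε ≤ ε₀ → ∀ x : ℝ, 0 < x → x < δ → ∀ v v' : ℝ, 0 < v → v ≤ v' →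
      v' < ε → lmass lo hi a (av (bpt x₁ P Q x v)) ≤
        CΛ * ENNReal.ofReal ((1 + Real.log (v' / v)) ^ Kn) * lmass lo hi a (av (bpt x₁ P Q x v')))
    (hrad : ∀ δ ε : ℝ, δ ≤ δ₀ → ε ≤ ε₀ → ∀ v : ℝ, 0 < v → v < ε → ∀ x x' : ℝ, 0 < x → x ≤ x' →
      x' < δ → lmass lo hi a (av (bpt x₁ P Q x v)) ≤
        CΛ * ENNReal.ofReal ((1 + Real.log (x' / x)) ^ Kn) * lmass lo hi a (av (bpt x₁ P Q x' v)))
    {δ ε : ℝ} (hδ : 0 < δ) (hε : 0 < ε) (h4δ : 4 * δ ≤ δ₀) (h4ε : 4 * ε ≤ ε₀)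
    (hδ1 : 4 * δ ≤ 1) (hεW : 4 * ε ≤ ρW) (hδl : 4 * δ ≤ |x₁ 1 - (l₁ * x₁ 0 + l₂)| / 2)
    (hsign : (∀ t ∈ Ioo (0 : ℝ) (4 * δ), ∀ v ∈ Ioo (0 : ℝ) (4 * ε),
        bpt x₁ P Q t v ∈ {x : Fin 2 → ℝ | ∀ j, 0 < av x (M j)}) ∨
      (∀ t ∈ Ioo (0 : ℝ) (4 * δ), ∀ v ∈ Ioo (0 : ℝ) (4 * ε),
        bpt x₁ P Q t v ∉ {x : Fin 2 → ℝ | ∀ j, 0 < av x (M j)})) :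
    ∫⁻ z in sector x₁ P Q δ (Ico 0 ε), {x : Fin 2 → ℝ | ∀ j, 0 < av x (M j)}.indicator
      (fun x => (∑ i ∈ Finset.range N, ENNReal.ofReal |Ri i x|) * lmass lo hi a (av x)) z < ∞ := by
  have hYm := measurableSet_Y M
  set lam₁ := x₁ 1 - (l₁ * x₁ 0 + l₂) with hlam₁
  set m : (Fin 2 → ℝ) → ℝ≥0∞ := fun x => lmass lo hi a (av x) with hm_def
  have hm : Measurable m := measurable_lmass_av lo hi a
  have hp0 : p ≠ 0 := sigma_ne_zero hp
  have hq0 : q₀ ≠ 0 := sigma_ne_zero hq₀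
  have hdet : P 0 * Q 1 - Q 0 * P 1 ≠ 0 := by
    rw [hP, hQ, vframe_det]; exact neg_ne_zero.2 (mul_ne_zero hq0 hp0)
  rcases hsign with hin4 | hout
  swap
  · rw [sector_zero N x₁ P Q hYm hm hRim hdet fun t ht v hv => hout t (Ioo_four hδ ht) v (Ioo_four hε hv)]
    exact ENNReal.zero_lt_top
  have hin : ∀ t ∈ Ioo (0 : ℝ) δ, ∀ v ∈ Ioo (0 : ℝ) ε,
      bpt x₁ P Q t v ∈ {x : Fin 2 → ℝ | ∀ j, 0 < av x (M j)} := fun t ht v hv =>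
    hin4 t (Ioo_four hδ ht) v (Ioo_four hε hv)
  refine sector_finite N x₁ P Q hYm hm hRim hdet hin ?_
  have hfin := hfin_of_inside x₁ P Q hm hRm hfinY hdet hin4
  -- the data of the ray theorem
  set T := Finset.range N ×ˢ Finset.range N' with hT
  set κ' : ℕ × ℕ → ℝ := fun im => recentre N cc lam₁ im * q₀ ^ im.2 * p ^ im.1 with hκ'
  set ω : ℝ → ℝ → ℝ := fun t v => |W₁ (t * (v * q₀))| * |lam₁ + t * p| ^ n with hω_def
  set Λ' : ℝ → ℝ → ℝ≥0∞ := fun t v => m (bpt x₁ P Q t v) with hΛ'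
  have hωm : Measurable (Function.uncurry ω) := by
    refine Measurable.mul ?_ ?_
    · exact continuous_abs.measurable.comp (hW₁c.measurable.comp
        (measurable_fst.mul (measurable_snd.mul_const _)))
    · exact ((continuous_abs.measurable.comp (measurable_const.add (measurable_fst.mul_const _))).pow_const n)
  have hΛm : Measurable (Function.uncurry Λ') := measurable_lmass_bpt lo hi a x₁ P Q
  have htv : ∀ t ∈ Ioo (0 : ℝ) (4 * δ), ∀ v ∈ Ioo (0 : ℝ) (4 * ε), |t * (v * q₀)| < ρW := by
    intro t ht v hv
    rw [abs_mul, abs_mul, abs_of_pos ht.1, abs_of_pos hv.1, hq₀, mul_one]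
    calc t * v < 4 * δ * (4 * ε) := mul_lt_mul'' ht.2 hv.2 ht.1.le hv.1.le
      _ ≤ 1 * (4 * ε) := mul_le_mul_of_nonneg_right hδ1 (by linarith)
      _ ≤ ρW := by linarith
  have hWt : ∀ t ∈ Ioo (0 : ℝ) (4 * δ), ∀ v ∈ Ioo (0 : ℝ) (4 * ε),
      |W₁ 0| / 2 ≤ |W₁ (t * (v * q₀))| ∧ |W₁ (t * (v * q₀))| ≤ CW := fun t ht v hv =>
    hWb _ (htv t ht v hv)
  have hW0 : 0 < |W₁ 0| / 2 := half_pos (abs_pos.2 hW₁0)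
  have hl0 : 0 < |lam₁| / 2 := half_pos (abs_pos.2 hlam)
  have hlt : ∀ t ∈ Ioo (0 : ℝ) (4 * δ), |lam₁| / 2 ≤ |lam₁ + t * p| ∧ |lam₁ + t * p| ≤ 3 * |lam₁| / 2 := by
    intro t ht
    refine lam_bounds ?_
    rw [abs_mul, abs_of_pos ht.1, hp, mul_one]
    linarith [ht.2]
  have hωlo : 0 < |W₁ 0| / 2 * (|lam₁| / 2) ^ n := mul_pos hW0 (pow_pos hl0 n)
  have hω : ∀ t ∈ Ioo (0 : ℝ) (4 * δ), ∀ v ∈ Ioo (0 : ℝ) (4 * ε),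
      |W₁ 0| / 2 * (|lam₁| / 2) ^ n ≤ ω t v ∧ ω t v ≤ CW * (3 * |lam₁| / 2) ^ n := fun t ht v hv =>
    ⟨mul_le_mul (hWt t ht v hv).1 (pow_le_pow_left₀ hl0.le (hlt t ht).1 n) (by positivity)
        (abs_nonneg _),
      mul_le_mul (hWt t ht v hv).2 (pow_le_pow_left₀ (abs_nonneg _) (hlt t ht).2 n) (by positivity)
        ((abs_nonneg _).trans (hWt t ht v hv).2)⟩
  have hden : ∀ t ∈ Ioo (0 : ℝ) (4 * δ), ∀ v ∈ Ioo (0 : ℝ) (4 * ε),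
      |W₁ (t * (v * q₀)) * (lam₁ + t * p) ^ n| = t ^ 0 * |v| ^ 0 * ω t v ∧
      0 < t ^ 0 * |v| ^ 0 * ω t v := fun t ht v hv =>
    vframe_den_away (hW0.trans_le (hWt t ht v hv).1) (hl0.trans_le (hlt t ht).1)
  -- the integrand and the pieces in blown-up coordinates
  have hR' : ∀ t ∈ Ioo (0 : ℝ) (4 * δ), ∀ v ∈ Ioo (0 : ℝ) (4 * ε),
      ENNReal.ofReal t * (ENNReal.ofReal |R (bpt x₁ P Q t v)| * m (bpt x₁ P Q t v)) =
        ENNReal.ofReal |usum T κ' Prod.snd t (0 + 1 * v)| * wt 0 0 0 1 ω Λ' t v := by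
    intro t ht v hv
    rw [hR, hP, hQ, vframe_fst, vframe_lam, dsum_snd_recentre cc N N' lam₁ q₀ p t v]
    simp only [wt, phi, zero_add, one_mul]
    rw [← hP, ← hQ]
    exact piece_eq_wt ht.1.le rfl (hden t ht v hv).1 (hden t ht v hv).2 _
  set Cb : ℝ := ∑ i' ∈ Finset.range N, (∑ m ∈ Finset.range N', |cc (i', m)|) * (3 * |lam₁| / 2) ^ i'
    with hCb
  have hRi' : ∀ i ∈ Finset.range N, ∀ t ∈ Ioo (0 : ℝ) δ, ∀ v ∈ Ioo (0 : ℝ) ε,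
      ENNReal.ofReal t * (ENNReal.ofReal |Ri i (bpt x₁ P Q t v)| * m (bpt x₁ P Q t v)) ≤
        ENNReal.ofReal Cb * wt 0 0 0 1 ω Λ' t v := by
    intro i hi t ht v hv
    have ht4 := Ioo_four hδ ht
    have hv4 := Ioo_four hε hv
    rw [hRi i hi, hP, hQ, vframe_fst, vframe_lam]
    simp only [wt, phi, zero_add, one_mul]
    rw [← hP, ← hQ]
    refine piece_le_wt ht.1.le (abs_piece_num_le cc N N' ((htv t ht4 v hv4).le.trans hρW1)
      (hlt t ht4).2 i hi) (hden t ht4 v hv4).1 (hden t ht4 v hv4).2 _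
  have hmono' := hmono δ ε h4δ h4ε
  have hang' := hang δ ε (by linarith) (by linarith)
  have hrad' := hrad δ ε (by linarith) (by linarith)
  have hne : ∃ im ∈ T, κ' im ≠ 0 :=
    exists_ne_zero_snd (exists_recentre_ne_zero N N' cc lam₁ hcc) hq0 hp0
  exact step_away N x₁ P Q T κ' Prod.snd 0 1 ω Λ' (ENNReal.ofReal Cb) ENNReal.ofReal_ne_top hR' hRi'
    (fun h => ray_away T κ' Prod.snd (N + N') (deg_prod N N') (snd_le_prod N N') (inj_snd T)
      abs_one hωm hΛm hδ hε hωlo hω KΛ hKΛ hmono' Kn CΛ hCΛ hang' hrad' h hne) hfin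

end SepTwo

/-- **The density on a vertical thin sector at a point off the pole line is finite**
(registered part of `stub_separateTwoPos_hI`; restatement of `SepTwo.vsector_away`). -/
theorem separateTwo_hiAway {k m' : ℕ} (M : Fin m' → SepTwo.Atm 2) (lo hi : Fin k → Fin k ⊕ SepTwo.Atm 2) (a : Fin k → Option (SepTwo.Atm 2)) (N N' : ℕ) (cc : ℕ × ℕ → ℝ) (n : ℕ) (W₁ : ℝ → ℝ) (l₁ l₂ : ℝ) (x₁ : Fin 2 → ℝ) (R : (Fin 2 → ℝ) → ℝ) (Ri : ℕ → (Fin 2 → ℝ) → ℝ) (hlam : x₁ 1 - (l₁ * x₁ 0 + l₂) ≠ 0) (hcc : ∃ im ∈ Finset.range N ×ˢ Finset.range N', cc im ≠ 0) (hR : ∀ x, R x = (∑ i ∈ Finset.range N, (∑ m ∈ Finset.range N', cc (i, m) * (x 0 - x₁ 0) ^ m) * (x 1 - (l₁ * x 0 + l₂)) ^ i) / (W₁ (x 0 - x₁ 0) * (x 1 - (l₁ * x 0 + l₂)) ^ n)) (hRi : ∀ i ∈ Finset.range N, ∀ x, Ri i x = (∑ m ∈ Finset.range N', cc (i, m) *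 (x 0 - x₁ 0) ^ m) * (x 1 - (l₁ * x 0 + l₂)) ^ i / (W₁ (x 0 - x₁ 0) * (x 1 - (l₁ * x 0 + l₂)) ^ n)) (hRm : Measurable R) (hRim : ∀ i, Measurable (Ri i)) (hW₁c : Continuous W₁) (hW₁0 : W₁ 0 ≠ 0) {ρW CW : ℝ} (hρW1 : ρW ≤ 1) (hWb : ∀ u : ℝ, |u| < ρW → |W₁ 0| / 2 ≤ |W₁ u| ∧ |W₁ u| ≤ CW) (hfinY : MeasureTheory.lintegral (MeasureTheory.volume.restrict {x | ∀ j, 0 < SepTwo.av x (M j)}) (fun x => ENNReal.ofReal |R x| * SepTwo.lmass lo hi a (SepTwo.av x)) < ⊤) {p q₀ : ℝ} (hp : |p| = 1) (hq₀ : |q₀| = 1) (P Q : Fin 2 → ℝ) (hP : P = ![0, p]) (hQ : Q = ![q₀, q₀ * l₁]) {δ₀ ε₀ : ℝ} {KΛ CΛ : ENNReal} {Kn : ℕ} (hKΛ : KΛ ≠ ⊤) (hCΛ : CΛ ≠ ⊤) (hmono : ∀ δ ε : ℝ, 4 * δ ≤ δ₀ → 4 * ε ≤ ε₀ → ∀ x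 v x' v' : ℝ, 0 < x → x ≤ x' → x' ≤ 4 * x → x' < 4 * δ → 0 < v → v ≤ v' → v' ≤ 4 * v → v' < 4 * ε → SepTwo.lmass lo hi a (SepTwo.av (SepTwo.bpt x₁ P Q x v)) ≤ KΛ * SepTwo.lmass lo hi a (SepTwo.av (SepTwo.bpt x₁ P Q x' v'))) (hang : ∀ δ ε : ℝ, δ ≤ δ₀ → ε ≤ ε₀ → ∀ x : ℝ, 0 < x → x < δ → ∀ v v' : ℝ, 0 < v → v ≤ v' → v' < ε → SepTwo.lmass lo hi a (SepTwo.av (SepTwo.bpt x₁ P Q x v)) ≤ CΛ * ENNReal.ofReal ((1 + Real.log (v' / v)) ^ Kn) * SepTwo.lmass lo hi a (SepTwo.av (SepTwo.bpt x₁ P Q x v'))) (hrad : ∀ δ ε : ℝ, δ ≤ δ₀ → ε ≤ ε₀ → ∀ v : ℝ, 0 < v → v < ε → ∀ x x' : ℝ, 0 < x → x ≤ x' → x' < δ → SepTwo.lmass lo hi a (SepTwo.av (SepTwo.bpt x₁ P Q x v)) ≤ CΛ * ENNReal.ofReal ((1 + Real.log (x' / x)) ^ Kn) * SepTwo.lmass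 lo hi a (SepTwo.av (SepTwo.bpt x₁ P Q x' v))) {δ ε : ℝ} (hδ : 0 < δ) (hε : 0 < ε) (h4δ : 4 * δ ≤ δ₀) (h4ε : 4 * ε ≤ ε₀) (hδ1 : 4 * δ ≤ 1) (hεW : 4 * ε ≤ ρW) (hδl : 4 * δ ≤ |x₁ 1 - (l₁ * x₁ 0 + l₂)| / 2) (hsign : (∀ t ∈ Set.Ioo (0 : ℝ) (4 * δ), ∀ v ∈ Set.Ioo (0 : ℝ) (4 * ε), SepTwo.bpt x₁ P Q t v ∈ {x : Fin 2 → ℝ | ∀ j, 0 < SepTwo.av x (M j)}) ∨ (∀ t ∈ Set.Ioo (0 : ℝ) (4 * δ), ∀ v ∈ Set.Ioo (0 : ℝ) (4 * ε), SepTwo.bpt x₁ P Q t v ∉ {x : Fin 2 → ℝ | ∀ j, 0 < SepTwo.av x (M j)})) : MeasureTheory.lintegral (MeasureTheory.volume.restrict (SepTwo.sector x₁ P Q δ (Set.Ico 0 ε))) (fun z => {x : Fin 2 → ℝ | ∀ j, 0 < SepTwo.av x (M j)}.indicator (fun x => (∑ i ∈ Finset.range N, ENNReal.ofReal |Ri i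 x|) * SepTwo.lmass lo hi a (SepTwo.av x)) z) < ⊤ := by
  exact SepTwo.vsector_away M lo hi a N N' cc n W₁ l₁ l₂ x₁ R Ri hlam hcc hR hRi hRm hRim hW₁c hW₁0 hρW1 hWb hfinY hp hq₀ P Q hP hQ hKΛ hCΛ hmono hang hrad hδ hε h4δ h4ε hδ1 hεW hδl hsign

end Summit.KontsevichZagierPeriods.ArrangementNormalForm.JanusBands
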